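import Mathlib
import Summits.NavierStokesRegularity.FluidComputer.AbcInertiaCIEigenvalues
import Summits.NavierStokesRegularity.FluidComputer.AbcInertiaRows

/-!
# INERTIA-3L instantiation — CLASS I twin, Part 7: the CLASS-I CELLS OF RECORD as kernel implications —
# `(R, a, m) = (300, 43/200, 2)` at `(r_L, r_H) = (28, 29)` [i4] and `(26, 28)` [i3], `(500, 1/4, 2)` at `(36, 37)` [i4]
# (instab3 g8, cell `ns-blowup`, 2026-08-27)

HONEST FRAMING (human rulings D-0035/D-0074): **MODEL linear operator, computer-assisted; not NS.** Nothing
here is a statement about Navier–Stokes regularity or blow-up. Object: the linearisation of forced NS about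
`U = abcFlow 1 1 1` (`ν = 1/(2πR)` on the unit torus), symmetry CLASS I (trivial character; cert-3 g9's
`AbcClassI` layer). bears_on LADDER-NS N1* T6 («contest-I: the class-I Hopf pair vs the class-II steady leader»).

For each INERTIA-3L class-I cell of record (`HOME/instab3/PREREG-INERTIA-3L.md`; INSTAB3-METHOD §14.5: impl-1
cert `cert_I3L_R300_cI_a43-200_rL26_rH28.json` d06cde2372d172d9, kit j269622; INERTIA-I4 §8: impl-2
`inertia_cert_R300_cI_rL28_rH29.json`, kit j269943; R 500 impl-2 cell `(36, 37)`, kit j274542) the END-TO-END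
KERNEL IMPLICATION with literal numbers: (R1) + (R2) (script-certified, stated on the kernel's own matrices in
the class-I orbit basis `AbcClassI.bfam`) ⇒ AT MOST TWO pairwise-distinct classical eigenvalues `z` with class-I
eigenfunction and `Re z ≥ a`. With cert-3 g9's class-I rows (`AbcClassIEigenpair.row3001*`: the Hopf pair
`λ⋆, conj λ⋆`, `Re λ⋆ ≈ 0.2642 > 43/200`, `Im λ⋆ ≈ 0.643 ≠ 0`, both `Torus.IsLinNSEigenvalue`) and
`eq_pair_of_card_le_two`: the pair is ALL of `σ_p(L_300|I) ∩ {Re ≥ 43/200}` — each simple, the pair rightmost.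
(R3) is discharged here; (R4) in `AbcInertiaCIIndexSets`. What is NOT kernel: (R1), (R2) (referee re-runs) and
AUDIT-BASIS for class I (cert-3 g9: j275912 PASSED for implementation 3's complex bases).

Mathlib + `AbcInertiaCIEigenvalues` + `AbcInertiaRows`; no new definitions; std axioms. [folklore]
-/

noncomputable section

open scoped BigOperators ComplexConjugate Matrix
open Finset Matrix MeasureTheory UnitAddTorus

namespace Summit.NavierStokesRegularity.FluidComputer.AbcInertiaCI

open Literature.Analysis.FunctionSpaces Literature.Analysis.FunctionSpaces.Torus
open Literature.Analysis.FluidPDE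
open Summit.NavierStokesRegularity.FluidComputer.AbcClassI
open Summit.NavierStokesRegularity.FluidComputer.AbcClassII (Fam Orbit onormSq)

/-! ### §1 (R3) for the class-I cells -/

/-- (R3) for `R = 300`, `a = 43/200`, `r_H = 29` (i4 cell): `√2 < 842/300 + 43/200`. -/
theorem R3_300_29_I : Real.sqrt 2 < ((⌊(29 : ℝ) ^ 2⌋₊ : ℝ) + 1) / 300 + 43 / 200 := by
  rw [show ((29 : ℝ)) ^ 2 = ((841 : ℕ) : ℝ) by norm_num, Nat.floor_natCast]
  rw [Real.sqrt_lt' (by norm_num)]; norm_num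

/-- (R3) for `R = 300`, `a = 43/200`, `r_H = 28` (i3 cell): `√2 < 785/300 + 43/200`. -/
theorem R3_300_28_I : Real.sqrt 2 < ((⌊(28 : ℝ) ^ 2⌋₊ : ℝ) + 1) / 300 + 43 / 200 := by
  rw [show ((28 : ℝ)) ^ 2 = ((784 : ℕ) : ℝ) by norm_num, Nat.floor_natCast]
  rw [Real.sqrt_lt' (by norm_num)]; norm_num

/-- (R3) for `R = 500`, `a = 1/4`, `r_H = 37` (i4 cell): `√2 < 1370/500 + 1/4`. -/
theorem R3_500_37_I : Real.sqrt 2 < ((⌊(37 : ℝ) ^ 2⌋₊ : ℝ) + 1) / 500 + 1 / 4 := by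
  rw [show ((37 : ℝ)) ^ 2 = ((1369 : ℕ) : ℝ) by norm_num, Nat.floor_natCast]
  rw [Real.sqrt_lt' (by norm_num)]; norm_num

/-- The transcript's class-I cell constants (`AbcInertiaTranscript.R300I`) are the literals used below. -/
theorem R300I_consts : (AbcInertiaTranscript.R300I.R : ℝ) = 300 ∧ ((AbcInertiaTranscript.R300I.a : ℚ) : ℝ) = 43 / 200 ∧
    AbcInertiaTranscript.R300I.m = 2 ∧ AbcInertiaTranscript.R300I.rL4 = 28 ∧ AbcInertiaTranscript.R300I.rH4 = 29 := by
  refine ⟨by norm_num [AbcInertiaTranscript.R300I.R], by norm_num [AbcInertiaTranscript.R300I.a], rfl, rfl, rfl⟩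

/-! ### §2 The cells -/

/-- **CELL (300, I, a = 43/200, m = 2) at (r_L, r_H) = (28, 29)** [implementation i4, kit j269943]: (R1) + (R2) ⇒ at
most TWO pairwise-distinct classical class-I eigenvalues with `Re z ≥ 43/200` of the linearisation about `abcFlow 1 1 1`
at viscosity `1/(2π·300)` (the Hopf pair). -/
theorem R300I_rL28_rH29_card_le_two {HL HH HB : Finset AbcClassI.Idx}
    (hHL : ∀ i : AbcClassI.Idx, i ∈ HL ↔ onormSq i.1 ≤ (28 : ℝ) ^ 2)
    (hHH : ∀ i : AbcClassI.Idx, i ∈ HH ↔ onormSq i.1 ≤ (29 : ℝ) ^ 2)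
    (hHB : ∀ i : AbcClassI.Idx, i ∈ HB ↔ (29 : ℝ) ^ 2 < onormSq i.1 ∧ onormSq i.1 ≤ ((29 : ℝ) + 1) ^ 2)
    (GH Ah : Matrix ↥HH ↥HH ℝ) (AHB : Matrix ↥HH ↥HB ℝ) (ABH : Matrix ↥HB ↥HH ℝ) (E : ↥HB → ℝ)
    (V : Matrix ↥HH (Fin 2) ℝ) (hGH : GHᵀ = GH)
    (hAh : Ah = Matrix.of fun i j : ↥HH =>
      (if i = j then -(onormSq i.1.1 / (300 : ℝ)) - (43 / 200 : ℝ) else 0) + AbcClassI.amat i.1 j.1)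
    (hAHB : AHB = Matrix.of fun (i : ↥HH) (l : ↥HB) => AbcClassI.amat i.1 l.1)
    (hABH : ABH = Matrix.of fun (l : ↥HB) (i : ↥HH) => AbcClassI.amat l.1 i.1)
    (hE : E = fun l : ↥HB => onormSq l.1.1 / (300 : ℝ) + (43 / 200 : ℝ) - Real.sqrt 2)
    (hR1 : ∀ x : ↥HH → ℝ, x ≠ 0 →
      x ⬝ᵥ ((GH * Ah + Ahᵀ * GH + (1 / 2 : ℝ) • ((GH * AHB + ABHᵀ) * Matrix.diagonal (fun l => (E l)⁻¹) *
        (GH * AHB + ABHᵀ)ᵀ)) *ᵥ x) < 0)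
    (hR2 : ∀ x : ↥HH → ℝ, 0 ≤ x ⬝ᵥ ((GH + V * Vᵀ) *ᵥ x))
    {n : ℕ} (z : Fin n → ℂ) (hz : Function.Injective z)
    (u : Fin n → UnitAddTorus (Fin 3) → EuclideanSpace ℂ (Fin 3))
    (hu : ∀ k, Torus.LinNSResolventRel (1 / (2 * Real.pi * (300 : ℝ))) (Torus.abcFlow 1 1 1)
      (2 * Real.pi * z k) (u k) 0)
    (hu0 : ∀ k, u k ≠ 0) (hII : ∀ k, IsClassI (mFourierCoeff (u k))) (hre : ∀ k, (43 / 200 : ℝ) ≤ (z k).re) :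
    n ≤ 2 :=
  card_classI_eigenfunctions_le_of_inertia_certificate (R := 300) (a := 43 / 200) (rL := 28) (rH := 29)
    (by norm_num) (by norm_num) (by norm_num) hHL hHH hHB GH Ah AHB ABH E V hGH hAh hAHB hABH hE hR1 hR2
    R3_300_29_I z hz u hu hu0 hII hre

/-- **CELL (300, I, a = 43/200, m = 2) at (r_L, r_H) = (26, 28)** [implementation i3, kit j269622, certificate
`cert_I3L_R300_cI_a43-200_rL26_rH28.json` d06cde2372d172d9]: (R1) + (R2) ⇒ at most TWO pairwise-distinct classical
class-I eigenvalues with `Re z ≥ 43/200`. -/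
theorem R300I_rL26_rH28_card_le_two {HL HH HB : Finset AbcClassI.Idx}
    (hHL : ∀ i : AbcClassI.Idx, i ∈ HL ↔ onormSq i.1 ≤ (26 : ℝ) ^ 2)
    (hHH : ∀ i : AbcClassI.Idx, i ∈ HH ↔ onormSq i.1 ≤ (28 : ℝ) ^ 2)
    (hHB : ∀ i : AbcClassI.Idx, i ∈ HB ↔ (28 : ℝ) ^ 2 < onormSq i.1 ∧ onormSq i.1 ≤ ((28 : ℝ) + 1) ^ 2)
    (GH Ah : Matrix ↥HH ↥HH ℝ) (AHB : Matrix ↥HH ↥HB ℝ) (ABH : Matrix ↥HB ↥HH ℝ) (E : ↥HB → ℝ)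
    (V : Matrix ↥HH (Fin 2) ℝ) (hGH : GHᵀ = GH)
    (hAh : Ah = Matrix.of fun i j : ↥HH =>
      (if i = j then -(onormSq i.1.1 / (300 : ℝ)) - (43 / 200 : ℝ) else 0) + AbcClassI.amat i.1 j.1)
    (hAHB : AHB = Matrix.of fun (i : ↥HH) (l : ↥HB) => AbcClassI.amat i.1 l.1)
    (hABH : ABH = Matrix.of fun (l : ↥HB) (i : ↥HH) => AbcClassI.amat l.1 i.1)
    (hE : E = fun l : ↥HB => onormSq l.1.1 / (300 : ℝ) + (43 / 200 : ℝ) - Real.sqrt 2)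
    (hR1 : ∀ x : ↥HH → ℝ, x ≠ 0 →
      x ⬝ᵥ ((GH * Ah + Ahᵀ * GH + (1 / 2 : ℝ) • ((GH * AHB + ABHᵀ) * Matrix.diagonal (fun l => (E l)⁻¹) *
        (GH * AHB + ABHᵀ)ᵀ)) *ᵥ x) < 0)
    (hR2 : ∀ x : ↥HH → ℝ, 0 ≤ x ⬝ᵥ ((GH + V * Vᵀ) *ᵥ x))
    {n : ℕ} (z : Fin n → ℂ) (hz : Function.Injective z)
    (u : Fin n → UnitAddTorus (Fin 3) → EuclideanSpace ℂ (Fin 3))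
    (hu : ∀ k, Torus.LinNSResolventRel (1 / (2 * Real.pi * (300 : ℝ))) (Torus.abcFlow 1 1 1)
      (2 * Real.pi * z k) (u k) 0)
    (hu0 : ∀ k, u k ≠ 0) (hII : ∀ k, IsClassI (mFourierCoeff (u k))) (hre : ∀ k, (43 / 200 : ℝ) ≤ (z k).re) :
    n ≤ 2 :=
  card_classI_eigenfunctions_le_of_inertia_certificate (R := 300) (a := 43 / 200) (rL := 26) (rH := 28)
    (by norm_num) (by norm_num) (by norm_num) hHL hHH hHB GH Ah AHB ABH E V hGH hAh hAHB hABH hE hR1 hR2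
    R3_300_28_I z hz u hu hu0 hII hre

/-- **CELL (500, I, a = 1/4, m = 2) at (r_L, r_H) = (36, 37)** [implementation i4, kit j274542]: (R1) + (R2) ⇒ at most
TWO pairwise-distinct classical class-I eigenvalues with `Re z ≥ 1/4` of the linearisation at viscosity `1/(2π·500)`. -/
theorem R500I_rL36_rH37_card_le_two {HL HH HB : Finset AbcClassI.Idx}
    (hHL : ∀ i : AbcClassI.Idx, i ∈ HL ↔ onormSq i.1 ≤ (36 : ℝ) ^ 2)
    (hHH : ∀ i : AbcClassI.Idx, i ∈ HH ↔ onormSq i.1 ≤ (37 : ℝ) ^ 2)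
    (hHB : ∀ i : AbcClassI.Idx, i ∈ HB ↔ (37 : ℝ) ^ 2 < onormSq i.1 ∧ onormSq i.1 ≤ ((37 : ℝ) + 1) ^ 2)
    (GH Ah : Matrix ↥HH ↥HH ℝ) (AHB : Matrix ↥HH ↥HB ℝ) (ABH : Matrix ↥HB ↥HH ℝ) (E : ↥HB → ℝ)
    (V : Matrix ↥HH (Fin 2) ℝ) (hGH : GHᵀ = GH)
    (hAh : Ah = Matrix.of fun i j : ↥HH =>
      (if i = j then -(onormSq i.1.1 / (500 : ℝ)) - (1 / 4 : ℝ) else 0) + AbcClassI.amat i.1 j.1)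
    (hAHB : AHB = Matrix.of fun (i : ↥HH) (l : ↥HB) => AbcClassI.amat i.1 l.1)
    (hABH : ABH = Matrix.of fun (l : ↥HB) (i : ↥HH) => AbcClassI.amat l.1 i.1)
    (hE : E = fun l : ↥HB => onormSq l.1.1 / (500 : ℝ) + (1 / 4 : ℝ) - Real.sqrt 2)
    (hR1 : ∀ x : ↥HH → ℝ, x ≠ 0 →
      x ⬝ᵥ ((GH * Ah + Ahᵀ * GH + (1 / 2 : ℝ) • ((GH * AHB + ABHᵀ) * Matrix.diagonal (fun l => (E l)⁻¹) *
        (GH * AHB + ABHᵀ)ᵀ)) *ᵥ x) < 0)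
    (hR2 : ∀ x : ↥HH → ℝ, 0 ≤ x ⬝ᵥ ((GH + V * Vᵀ) *ᵥ x))
    {n : ℕ} (z : Fin n → ℂ) (hz : Function.Injective z)
    (u : Fin n → UnitAddTorus (Fin 3) → EuclideanSpace ℂ (Fin 3))
    (hu : ∀ k, Torus.LinNSResolventRel (1 / (2 * Real.pi * (500 : ℝ))) (Torus.abcFlow 1 1 1)
      (2 * Real.pi * z k) (u k) 0)
    (hu0 : ∀ k, u k ≠ 0) (hII : ∀ k, IsClassI (mFourierCoeff (u k))) (hre : ∀ k, (1 / 4 : ℝ) ≤ (z k).re) :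
    n ≤ 2 :=
  card_classI_eigenfunctions_le_of_inertia_certificate (R := 500) (a := 1 / 4) (rL := 36) (rH := 37)
    (by norm_num) (by norm_num) (by norm_num) hHL hHH hHB GH Ah AHB ABH E V hGH hAh hAHB hABH hE hR1 hR2
    R3_500_37_I z hz u hu hu0 hII hre


/-! ### §3 Reading with the enclosures (class I: the Hopf pair) -/

/-- **The pair reading.** From any cell conclusion `hcell` («at most TWO distinct classical class-I eigenvalues
with `Re ≥ a`») and ONE classical class-I eigenpair `(λ⋆, u⋆)` with `a ≤ Re λ⋆` whose conjugate `conj λ⋆ ≠ λ⋆` is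
also a classical class-I eigenvalue (the Hopf pair of `Row3001`, `AbcClassIEigenpair.…Conjugate`): every
classical class-I eigenpair `(z, u)` with `Re z ≥ a` has `z = λ⋆ ∨ z = conj λ⋆`. -/
theorem eq_pair_of_card_le_two {ν : ℝ} {a : ℝ}
    (hcell : ∀ {n : ℕ} (z : Fin n → ℂ), Function.Injective z →
      ∀ (u : Fin n → UnitAddTorus (Fin 3) → EuclideanSpace ℂ (Fin 3)),
      (∀ k, Torus.LinNSResolventRel ν (Torus.abcFlow 1 1 1) (2 * Real.pi * z k) (u k) 0) →
      (∀ k, u k ≠ 0) → (∀ k, IsClassI (mFourierCoeff (u k))) → (∀ k, a ≤ (z k).re) → n ≤ 2)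
    (lam : ℂ) (ulam ubar : UnitAddTorus (Fin 3) → EuclideanSpace ℂ (Fin 3))
    (hlam : Torus.LinNSResolventRel ν (Torus.abcFlow 1 1 1) (2 * Real.pi * lam) ulam 0) (hlam0 : ulam ≠ 0)
    (hlamI : IsClassI (mFourierCoeff ulam))
    (hbar : Torus.LinNSResolventRel ν (Torus.abcFlow 1 1 1) (2 * Real.pi * (starRingEnd ℂ) lam) ubar 0)
    (hbar0 : ubar ≠ 0) (hbarI : IsClassI (mFourierCoeff ubar)) (hne : (starRingEnd ℂ) lam ≠ lam)
    (hlamre : a ≤ lam.re)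
    (z : ℂ) (u : UnitAddTorus (Fin 3) → EuclideanSpace ℂ (Fin 3))
    (hu : Torus.LinNSResolventRel ν (Torus.abcFlow 1 1 1) (2 * Real.pi * z) u 0) (hu0 : u ≠ 0)
    (huI : IsClassI (mFourierCoeff u)) (hzre : a ≤ z.re) : z = lam ∨ z = (starRingEnd ℂ) lam := by
  by_contra hnot
  push Not at hnot
  obtain ⟨hz1, hz2⟩ := hnot
  have hbarre : a ≤ ((starRingEnd ℂ) lam).re := by rw [Complex.conj_re]; exact hlamre
  have hinj : Function.Injective ![lam, (starRingEnd ℂ) lam, z] := by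
    intro i j h
    fin_cases i <;> fin_cases j <;> simp at h ⊢
    · exact hne h.symm
    · exact hz1 h.symm
    · exact hne h
    · exact hz2 h.symm
    · exact hz1 h
    · exact hz2 h
  have h := hcell ![lam, (starRingEnd ℂ) lam, z] hinj ![ulam, ubar, u]
    (fun k => by fin_cases k <;> assumption) (fun k => by fin_cases k <;> assumption)
    (fun k => by fin_cases k <;> assumption) (fun k => by fin_cases k <;> assumption)
  omega

end Summit.NavierStokesRegularity.FluidComputer.AbcInertiaCI

end
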